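import Literature.MathematicalPhysics.QuantumFieldTheory.Balaban1983to89.B9Ineq346L2RightDiff
import Literature.MathematicalPhysics.QuantumFieldTheory.Balaban1983to89.B9Thm34GpKernelUniform

/-!
# `Balaban1983to89.B9Ineq346L2RightDiffUniform` — [Balaban1985BackgroundPropagators] THEOREM 3.4 p. 400 × THEOREM 3.1 (3.46)₆ p. 398: THE `L²`
# MEMBER WITH TWO DIFFERENCES ON THE RIGHT, `‖hG′∇*_U∇*_Uλ‖ ≦ B₀|h|e^{−δ₀d(y,y′)}‖λ‖`, FOR THE CONCRETE EXTENDED `G′(U′U)` OF (3.64), WITH THE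
# CONSTANTS CHOSEN BEFORE THE LATTICE: `∃ a₁ > 0 ∃ B ∀ (T_η, k, {Ω_j}, U, …) ∀ α₁ ≦ a₁ ∀ A …` — FILE 41 `thm34_Gp_l2_right_final` re-quantified
# (FILE 60 of the Sect. B programme of cell `lit-balaban`, seat r06 gen 21; the third `L²` file of the uniformity series, after FILES 58/59)

statement-level skeleton of published theorems with citation tags; proofs where landed; nothing here is a claim about the Yang–Mills mass gap

CITATION HEADER (lean-in-tree rule).  B9 = T. Bałaban, *Propagators for lattice gauge theories in a background field*, Commun. Math. Phys.
**99** (1985) 389–434 [Balaban1985BackgroundPropagators] (held `paper:balaban1985-cmp99-background-propagators`; journal page = PDF page + 388):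
Theorem 3.4 p. 400 [PDF 12] L7–10 «There exists a positive constant a₁ such that the operators G′(U), (Q′(U)G′²(U)Q′*(U))⁻¹, R(U), G(U) extend
to configurations U′U for α₁ ≦ a₁ as analytic functions of A. The extended operators satisfy all the inequalities of Theorems 3.1–3.3
correspondingly»; Theorem 3.1 p. 397 [PDF 9] «There exist positive constants M₁, δ₀, a₀, B₀ dependent on d and L only»; (3.46) p. 398 [PDF 10]
(the `L²` members; ‖hG′(U)∇*_U∇*_Uλ‖ ≦ B₀|h|e^{−δ₀d(y,y′)}‖λ‖ is the sixth); the remarks after (3.47) p. 398 («the choice of derivatives ∇_U, ∇*_U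
is conventional»; «Using Lemma 2.1 in [4] we may replace the factor (Lʲη)^α by (Lʲη)^β(L^{j′}η)^γ»); p. 399 L1–3 «Let us stress that the constants
in the formulations of both theorems do not depend on the sequence {Ω_j} …»; (3.37) p. 396, (3.52) p. 400, (3.60)–(3.65) p. 402 [PDF 14]; p. 403
[PDF 15] l. 2–9 «of course with different constants»; the kernel pairing p. 393.  [Balaban1985RegularSpaces] (1.87) p. 91.  [4] =
[Balaban1984PropagatorsII] (2.51)–(2.55) p. 232, (2.64)–(2.66) p. 234, Lemma 2.1 p. 234 [PDF 12].  Rows B9.Thm3.4 × B9.Thm3.1 ((3.46) cell) ×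
B9.Eq3.62 × B9.Eq3.60 (cells only; no row head changes).

WHY THIS FILE (B9-CLOSURE §3 item 4 remainder, `L²` part; v4.3/v4.4: 39 → 58, 40 → 59).  FILE 41 packages `a₁`, `B` after the lattice; its
proof computes the threshold and the constant `B = B₄₆(1 + c_vΛ_v·A_W·c₁(δ₀,1/100))`, `A_W = Λ_v²Λc₁B′K`, from lattice-free quantities (FILE 29's
constant `B′`, the continuity bound `K` of the `α₁`-dependent constant `Θ(α₁)` of the column bounds) — except for `Λ`, `Λ_v` (per-lattice `∃ Λ ≧
1`) and the sign of `c_v` (from `hvol` at a site).  Here (as in FILES 58/59) both scale transfers are hypothesised in their printed uniform form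
(`Λf`, `Λvf` fixed before the lattice), `c_v` is an input with its sign (`hcv`; print: `c_v = 1`), the input constant `B₄₆` of (3.46)₆ FOR `U`
is theorem-level, the per-lattice callee is replaced by FILE 49 `thm34_Gp_kernel_uniform` invoked BEFORE the lattice, and the quantifiers are
re-ordered.

WHAT IS PROVED (1 theorem: 0 `def`, 0 sorry, 0 new named facts; standard axioms).
* **`thm34_Gp_l2_right_uniform`** — FILE 41 `thm34_Gp_l2_right_final` verbatim in hypotheses (named binders inside the `∀`, less `hrepr`, `cv`,
  `B46`/`hB46`; `hST`, `hSTv` in the uniform form; (3.46)₆ FOR `G′(U)` as the `L²` block input `h346`) and conclusion (`G′(U′U)` = two-sided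
  inverse of `Δ′_a(U) − V′(A)` ∧ `∀ k m ∀ y y′ ∀ h` (`|h| ≦ H`, `supp h ⊂ Δ(y)`) `∀ λ` (`supp λ ⊂ Δ(y′)`): `‖h·G′(U′U)∇_k∇_mλ‖₂ ≦
  BHe^{−(19δ₀/25)d(y,y′)}‖λ‖₂`), quantified `∃ a₁ > 0 ∃ B ≧ 0 ∀ (lattice, background, letters, Theorem 3.1 for G′(U) in kernel form, block
  volumes, v^{−1/2}-transfer, (3.46)₆ for G′(U)) ∀ α₁ ≦ a₁ ∀ A kF sF …`.
(FILE 41's per-lattice statement follows by instantiation with `Λf := fun _ => Λ`, `Λvf := fun _ => Λ_v` and the derived sign of `c_v`.)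

PROOF.  FILE 41's proof verbatim after the re-ordering (scripted: `work/unif.py` `make_uniform_file` with the `L²` hooks + `work/gen60.py`): the
uniform callee, the continuity threshold/bound and the constants `A_W`, `B` BEFORE the lattice; inside, the callee's `∀`-clause applied to the
lattice data, `hST`/`hSTv` at `1/100`, the squared `v⁻¹`-transfer, then FILE 41 §3 `hasKernelBound_mul_vPrime_right` (kernel of `W = G′(U′U)V′(A)`
from the column bounds of the concrete letters) and §4 `l2_right_transfer` BY NAME.

HONEST SCOPE / NOT CLAIMED.  As FILE 41 (module header there: counting `ℓ²` norms of the real coordinates; (3.46)₆ FOR `U` is an INPUT per pair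
of concrete first differences; the letters `∇_k`, `k ∈ κ ⊕ κ`, cover both orientations — «conventional»).  NEW relative to FILE 41: `c_v`,
`Λ_v(·)`, `B₄₆` are inputs fixed before the lattice (`hcv`, `hΛvf`, `hB46`) — the printed situation.  The uniformity displayed is uniformity in
`(S, T, 𝔅, blk)`, `U`, the operators, the letters, `v`, `c`, the (3.46)₆ input AT FIXED input constants, `κ`, `(𝔸, b)`, `Λ(·)`, `Λ_v(·)`, `c_v`.
The `G(U′U)` companion ((3.46)₆ for the operator of FILE 28/48) is FILE 61.  NOT summit progress.

RELATED IN THE TREE, NOT DUPLICATED (searched 2026-08-23: `lean search 'l2_right_uniform' --decl` = ∅): FILE 41 `B9Ineq346L2RightDiff`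
(per-lattice; §3/§4 devices USED BY NAME), FILE 49 `B9Thm34GpKernelUniform.thm34_Gp_kernel_uniform` — USED BY NAME; no existing module modified.
-/

noncomputable section

namespace Literature.MathematicalPhysics.QuantumFieldTheory.Balaban1983to89.B9Ineq346L2RightDiffUniform

open NormedSpace Complex
open Literature.MathematicalPhysics.QuantumFieldTheory.Balaban1983to89
open Literature.MathematicalPhysics.QuantumFieldTheory.Balaban1983to89.B6RandomWalk (HasMajorant BlockSupp blockPiece sum_blockPiece hasMajorant_mono Triangle254 Ineq261)
open Literature.MathematicalPhysics.QuantumFieldTheory.Balaban1983to89.B6RandomWalkKernel (ker apply_single_eq apply_eq_sum_single ker_mul_apply HasKernelBound hasKernelBound_mono hasKernelBound_add)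
open Literature.MathematicalPhysics.QuantumFieldTheory.Balaban1983to89.B9Thm34Ext (toB6)
open Literature.MathematicalPhysics.QuantumFieldTheory.Balaban1983to89.B9Ineq347 (ScaleTransfer)
open Literature.MathematicalPhysics.QuantumFieldTheory.Balaban1983to89.B9Ineq385Kernel (exp_rate_mono)
open Literature.MathematicalPhysics.QuantumFieldTheory.Balaban1983to89.B9Ineq366CPrime (conv_le scaleTransfer_one)
open Literature.MathematicalPhysics.QuantumFieldTheory.Balaban1983to89.Beta.BackgroundVertices (ad norm_ad_le)
open Literature.MathematicalPhysics.QuantumFieldTheory.Balaban1983to89.B9Eq39Adjoint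
open Literature.MathematicalPhysics.QuantumFieldTheory.Balaban1983to89.B9Eq352DivForm (tauF tauB tauF_apply tauB_apply)
open Literature.MathematicalPhysics.QuantumFieldTheory.Balaban1983to89.B9Eq352DivFormLetters
open Literature.MathematicalPhysics.QuantumFieldTheory.Balaban1983to89.B9Eq352GradLetters (V0op coefLetter diffLetter coefLetter_inl coefLetter_inr
  diffLetter_inl diffLetter_inr norm_V0op_le_printed)
open Literature.MathematicalPhysics.QuantumFieldTheory.Balaban1983to89.B9Eq360Vprime (kerOp liftOp diagOp kerOp_apply liftOp_apply diagOp_apply block mem_block)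
open Literature.MathematicalPhysics.QuantumFieldTheory.Balaban1983to89.B9Eq360VprimeLetters (vPrimeConc avgOp_apply conj_vPrimeConc_eq_gradForm)
open Literature.MathematicalPhysics.QuantumFieldTheory.Balaban1983to89.B9Eq360Vprime (gPrimeExtEnd)
open Literature.MathematicalPhysics.QuantumFieldTheory.Balaban1983to89.B9Ineq346L2Final (l2_block_of_kernelBound_transfer)
open Literature.MathematicalPhysics.QuantumFieldTheory.Balaban1983to89.B9Thm34GKernelFinal (exists_bound_of_continuousAt)
open Literature.MathematicalPhysics.QuantumFieldTheory.Balaban1983to89.B9Thm34GpKernelUniform (thm34_Gp_kernel_uniform)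
open Literature.MathematicalPhysics.QuantumFieldTheory.Balaban1983to89.B9Thm34HolderInputG (resolvent_right)
open Literature.MathematicalPhysics.QuantumFieldTheory.Balaban1983to89.B9Ineq346L2RightDiff (hasKernelBound_mul_vPrime_right l2_right_transfer)

section L2RU1

variable {𝔸 : Type*} [NormedRing 𝔸] [NormedAlgebra ℂ 𝔸] [CompleteSpace 𝔸] {ι : Type} [Fintype ι]
variable (b : Module.Basis ι ℝ 𝔸) (κ : Type) [Fintype κ]

set_option maxHeartbeats 1600000 in
/-- **THEOREM 3.4 × THEOREM 3.1: THE `L²` MEMBER (3.46)₆ `‖hG′∇*_U∇*_Uλ‖ ≦ B₀|h|e^{−δ₀d(y,y′)}‖λ‖` FOR THE CONCRETE `G′(U′U)` OF (3.64), THE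
CONSTANTS CHOSEN BEFORE THE LATTICE** (for `U′U` by Theorem 3.4 p. 400 «The extended operators satisfy all the inequalities of Theorems
3.1–3.3 correspondingly» and p. 403 l. 2–9; «the constants … do not depend on the sequence {Ω_j}», p. 399): `∃ a₁ > 0 ∃ B ≧ 0 ∀ (lattice 𝔅 =
g, background U, data, Theorem 3.1 for G′(U) = (Δ′_a(U))⁻¹ in kernel form, block volumes, [4] Lemma 2.1 for v^{−1/2}, (3.46)₆ FOR G′(U) as an
L² block input for every pair of concrete first differences ON THE RIGHT, constant B₄₆) ∀ α₁ ≦ a₁ ∀ A kF sF …`: `G′(U′U)` is the two-sided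
inverse of `Δ′_a(U) − V′(A)` ∧ `∀ k m ∀ y y′ ∀ h` (`|h| ≦ H`, `supp h ⊂ Δ(y)`) `∀ λ` (`supp λ ⊂ Δ(y′)`): `‖h·G′(U′U)∇_k∇_mλ‖₂ ≦
BHe^{−(19δ₀/25)d(y,y′)}‖λ‖₂` — FILE 41 `thm34_Gp_l2_right_final` verbatim, re-quantified; `c_v` (print: `1`), `Λ_v(·)`, `B₄₆` inputs fixed
before the lattice (`hcv`, `hΛvf`, `hB46`); `B = B₄₆(1 + c_vΛ_v(1/100)·(Λ_v(1/100)²Λ(1/100)c₁(δ₀,1/100)B₄₉K)·c₁(δ₀,1/100))`, `K` the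
continuity bound of `Θ(α₁)`; rate cascade `4δ₀/5 → 39δ₀/50 → 77δ₀/100 → 19δ₀/25`.
[cite: Balaban1985BackgroundPropagators, Thm 3.4 p.400 + p.399 + Thm 3.1 (3.46) p.398 + p.398 remarks + (3.60)–(3.65) p.402 + p.403 l.2–9 + p.393 + (3.37) p.396 + (3.52) p.400; Balaban1985RegularSpaces, (1.87) p.91; Balaban1984PropagatorsII, (2.51)–(2.55) p.232 + (2.64)–(2.66) p.234 + Lemma 2.1 p.234] -/
theorem thm34_Gp_l2_right_uniform [DecidableEq ι] (d : ℕ)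
    (δ₀ BG Cq a₀ d₀ M₂ : ℝ) (Λf Λvf : ℝ → ℝ) (cv B46 : ℝ)
    (hBG : 0 < BG) (hCq : 0 ≤ Cq) (ha₀ : 0 ≤ a₀) (hM₂ : 0 ≤ M₂) (hδ₀ : 0 < δ₀) (hΛf : ∀ α : ℝ, 0 < α → 1 ≤ Λf α)
    -- NEW AT THE THEOREM LEVEL (L² files): the `v^{−1/2}`-transfer constant `Λvf` ([4] Lemma 2.1), the sign of the pairing-volume constant `cv`, the (3.46)-for-`U` input constant `B46`
    (hΛvf : ∀ α : ℝ, 0 < α → 1 ≤ Λvf α) (hcv : 0 ≤ cv) (hB46 : 0 ≤ B46)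
    (hrepr : ∀ (v : 𝔸) (i : ι), |b.repr v i| ≤ M₂ * ‖v‖) :
    ∃ a₁ : ℝ, 0 < a₁ ∧ ∃ B : ℝ, 0 ≤ B ∧
    ∀ {S : Type} [Fintype S] [DecidableEq S] (T : κ → Equiv.Perm S) (U : κ → S → 𝔸ˣ)
      {g : B9.Geometry} [Fintype g.Site] [DecidableEq g.Site] [Nonempty g.Site] {Rr : ℝ} {H : Prop} (blk : S → g.Site)
      (kQ : g.Site → S → 𝔸 →L[ℝ] 𝔸) (sQ : S → 𝔸 →L[ℝ] 𝔸) (cfun w : g.Site → ℝ)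
    -- the multiscale geometry 𝔅 (p. 393, [4] (2.1)–(2.4)) and its axioms
    (hdnn : ∀ a a' : g.Site, 0 ≤ g.dist a a') (htri : Triangle254 (toB6 g Rr H)) (hrefl : ∀ y : g.Site, g.dist y y = 0)
    (hsym : ∀ y y' : g.Site, g.dist y y' = g.dist y' y) (hlen : ∀ y : g.Site, 0 < g.len y) (hlenη : ∀ y : g.Site, g.eta ≤ g.len y)
    (hη : 0 < g.eta)
    -- [4] Lemma 2.1 (2.61) at the rate `δ₀`, «for every 0 < α < 1», and the p. 398 scale transfer for every exponent
    (h261 : ∀ α : ℝ, 0 < α → α < 1 → Ineq261 d (toB6 g Rr H) δ₀ α)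
      (hST : ∀ α : ℝ, 0 < α → ScaleTransfer g δ₀ α (Λf α) (fun a => g.len a) ∧ ScaleTransfer g δ₀ α (Λf α) (fun a => g.len a ^ 2) ∧
        ScaleTransfer g δ₀ α (Λf α) (fun a => (g.len a)⁻¹) ∧ ScaleTransfer g δ₀ α (Λf α) (fun a => (g.len a ^ 2)⁻¹) ∧
        ScaleTransfer g δ₀ α (Λf α) (fun a => (g.len a ^ 4)⁻¹) ∧ ScaleTransfer g δ₀ α (Λf α) (fun y => g.len y ^ (-(4 : ℝ))))
    (hU1 : ∀ m z, ‖((U m z : 𝔸ˣ) : 𝔸)‖ ≤ 1 ∧ ‖(((U m z)⁻¹ : 𝔸ˣ) : 𝔸)‖ ≤ 1)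
    (hd₀B : ∀ μ x, g.dist (blk x) (blk ((T μ).symm x)) ≤ d₀) (hd₀F : ∀ μ x, g.dist (blk x) (blk (T μ x)) ≤ d₀)
    (hd₀0 : ∀ y : g.Site, g.dist y y ≤ d₀)
    -- the `A`-independent data of the concrete `V′(A)` of (3.60)
    (hw : ∀ y, 0 ≤ w y) (hcard : ∀ y, ((B9Eq360Vprime.block blk y).card : ℝ) * w y ≤ 1)
    (hkQ : ∀ y x, blk x = y → ‖kQ y x‖ ≤ w y) (hsQ : ∀ x, ‖sQ x‖ ≤ 1) (hcfun : ∀ y, |cfun y| ≤ a₀ * (g.len y ^ 2)⁻¹)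
    -- THEOREM 3.1 for `G′(U)`: (3.24) `G′(U) = (Δ′_a(U))⁻¹` for the letter `Δ′_a(U)`, and (3.42)₁,₂,₃ at the rate `δ₀`
    {Δp Gp : Module.End ℝ (S × ι → ℝ)} (hΔpGp : Δp * Gp = 1) (hGpΔp : Gp * Δp = 1)
    (h342_1 : HasMajorant (g := toB6 g Rr H) (fun p : S × ι => blk p.1) Gp
      (fun a a' => BG * g.len a ^ 2 * Real.exp (-(δ₀ * g.dist a a'))))
    (h342_2 : ∀ k : κ ⊕ κ, HasMajorant (g := toB6 g Rr H) (fun p : S × ι => blk p.1)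
      (conj b (diffLetter T U ((g.eta : ℂ)⁻¹) k) * Gp) (fun a a' => BG * g.len a * Real.exp (-(δ₀ * g.dist a a'))))
    (h342_3 : ∀ k : κ ⊕ κ, HasMajorant (g := toB6 g Rr H) (fun p : S × ι => blk p.1)
      (Gp * conj b (diffLetter T U ((g.eta : ℂ)⁻¹) k)) (fun a a' => BG * g.len a * Real.exp (-(δ₀ * g.dist a a'))))
    -- the kernel pairing of p. 393 (`c = η^d`, block volume weight `v(y′) = (L^{j′}η)^d`) and THEOREM 3.1's (3.42)₁₋₄ FOR `G′(U)` IN THE PRINTED KERNEL FORM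
    {v : g.Site → ℝ} (hv : ∀ y, 0 < v y) {cK : ℝ} (hcK : 0 < cK)
    (hGpk : HasKernelBound (g := toB6 g Rr H) (fun p : S × ι => blk p.1) v cK Gp
      (fun a a' => BG * g.len a ^ 2 * Real.exp (-(δ₀ * g.dist a a'))))
    (hDGpk : ∀ k : κ ⊕ κ, HasKernelBound (g := toB6 g Rr H) (fun p : S × ι => blk p.1) v cK
      (conj b (diffLetter T U ((g.eta : ℂ)⁻¹) k) * Gp) (fun a a' => BG * g.len a * Real.exp (-(δ₀ * g.dist a a'))))
    (hGpDk : ∀ l : κ ⊕ κ, HasKernelBound (g := toB6 g Rr H) (fun p : S × ι => blk p.1) v cK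
      (Gp * conj b (diffLetter T U ((g.eta : ℂ)⁻¹) l)) (fun a a' => BG * g.len a * Real.exp (-(δ₀ * g.dist a a'))))
    (hDGpDk : ∀ k l : κ ⊕ κ, HasKernelBound (g := toB6 g Rr H) (fun p : S × ι => blk p.1) v cK
      (conj b (diffLetter T U ((g.eta : ℂ)⁻¹) k) * Gp * conj b (diffLetter T U ((g.eta : ℂ)⁻¹) l)) (fun a a' => BG * Real.exp (-(δ₀ * g.dist a a'))))
    -- the block volumes in the kernel pairing (p. 393) and [4] Lemma 2.1 for the block-volume weight `v^{−1/2}` (p. 398 remark), as FILES 39/40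
    (hvol : ∀ y : g.Site, cK * ((Finset.univ.filter (fun p : S × ι => blk p.1 = y)).card : ℝ) ≤ cv * v y)
    (hSTv : ∀ α : ℝ, 0 < α → ScaleTransfer g δ₀ α (Λvf α) (fun y => (Real.sqrt (v y))⁻¹))
    -- NEW: THEOREM 3.1's (3.46)₆ FOR `G′(U)` in `L²` block form («‖hG′(U)∇*_U∇*_Uλ‖ ≦ B₀·1·|h|e^{−δ₀d(y,y′)}‖λ‖»), every pair of concrete first differences
    (h346 : ∀ (k m : κ ⊕ κ) (y y'' : g.Site) (hf ν : S × ι → ℝ) (Hh : ℝ), 0 ≤ Hh → (∀ x, |hf x| ≤ Hh) → (∀ x, blk x.1 ≠ y → hf x = 0) →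
      (∀ x, blk x.1 ≠ y'' → ν x = 0) →
      Real.sqrt (∑ x, (hf x * (Gp * (conj b (diffLetter T U ((g.eta : ℂ)⁻¹) k)) * (conj b (diffLetter T U ((g.eta : ℂ)⁻¹) m))) ν x) ^ 2) ≤ B46 * Hh * Real.exp (-(δ₀ * g.dist y y'')) * Real.sqrt (∑ x, ν x ^ 2)),
    ∀ (α₁ : ℝ), 0 ≤ α₁ → α₁ ≤ a₁ →
    -- the exponent field `A` in the domain (3.37), read blockwise, and the `A`-dependent (3.59) data `kF`, `sF`
    ∀ (A : κ → S → 𝔸) (kF : g.Site → S → 𝔸 →L[ℝ] 𝔸) (sF : S → 𝔸 →L[ℝ] 𝔸),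
      (∀ y x, blk x = y → ‖kF y x‖ ≤ Cq * α₁ * w y) → (∀ x, ‖sF x‖ ≤ Cq * α₁) →
      (∀ ν k x, ‖((g.eta : ℂ)⁻¹) • covDstar T U ν (A k) x‖ ≤ α₁ * (g.len (blk x) ^ 2)⁻¹) →
      (∀ μ ν x, ‖((g.eta : ℂ)⁻¹) • covD T U μ (A ν) x‖ ≤ α₁ * (g.len (blk x) ^ 2)⁻¹) →
      (∀ μ x, ‖((g.eta : ℂ)⁻¹) • covDstar T U μ (tauB T U μ (A μ)) x‖ ≤ α₁ * (g.len (blk x) ^ 2)⁻¹) →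
      (∀ k x, ‖A k x‖ ≤ α₁ * (g.len (blk x))⁻¹) → (∀ ν k x, ‖tauB T U ν (A k) x‖ ≤ α₁ * (g.len (blk x))⁻¹) →
      -- (i) `G′(U′U)` = the two-sided inverse of `Δ′_a(U) − V′(A)` (FILE 16/26, re-exported)
      (Δp - (conj b (vPrimeConc T U g.eta A blk kQ kF sQ sF cfun))) * (gPrimeExtEnd Gp (conj b (vPrimeConc T U g.eta A blk kQ kF sQ sF cfun) * Gp)) = 1 ∧
      (gPrimeExtEnd Gp (conj b (vPrimeConc T U g.eta A blk kQ kF sQ sF cfun) * Gp)) * (Δp - (conj b (vPrimeConc T U g.eta A blk kQ kF sQ sF cfun))) = 1 ∧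
      -- (viii″) NEW: the `L²` member (3.46)₆ of Theorem 3.1 for `G′(U′U)`, every pair of concrete first differences on the RIGHT
      (∀ (k m : κ ⊕ κ) (y y' : g.Site) (hf μ : S × ι → ℝ) (Hh : ℝ), 0 ≤ Hh → (∀ x, |hf x| ≤ Hh) → (∀ x, blk x.1 ≠ y → hf x = 0) →
        (∀ x, blk x.1 ≠ y' → μ x = 0) →
        Real.sqrt (∑ x, (hf x * ((gPrimeExtEnd Gp (conj b (vPrimeConc T U g.eta A blk kQ kF sQ sF cfun) * Gp)) * (conj b (diffLetter T U ((g.eta : ℂ)⁻¹) k)) * (conj b (diffLetter T U ((g.eta : ℂ)⁻¹) m))) μ x) ^ 2) ≤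
          B * Hh * Real.exp (-(19 / 25 * δ₀ * g.dist y y')) * Real.sqrt (∑ x, μ x ^ 2)) := by
  classical
  -- the scale-transfer constants of the chain, READ FROM THE GIVEN FUNCTIONS `Λf`, `Λvf` (lattice-free)
  have hΛ1 : 1 ≤ Λf (1 / 100) := hΛf _ (by norm_num)
  have hΛv1 : 1 ≤ Λvf (1 / 100) := hΛvf _ (by norm_num)
  -- FILE 49: thresholds, the constant `B₁₆`, the two inverse identities and the four kernel entries of `G′(U′U)` at the rate `4δ₀/5` — the uniform twins, BEFORE THE LATTICE
  obtain ⟨a₁, ha₁, B', hB', H16⟩ := thm34_Gp_kernel_uniform b κ d δ₀ BG Cq a₀ d₀ M₂ Λf hBG hCq ha₀ hM₂ hδ₀ hΛf hrepr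
  have hΛ0 : 0 ≤ (Λf (1 / 100)) := zero_le_one.trans hΛ1
  have hΛv0 : 0 ≤ (Λvf (1 / 100)) := zero_le_one.trans hΛv1
  have hc1 : 0 ≤ B6.c1 d δ₀ (1 / 100) := B6RandomWalk.c1_nonneg d δ₀ (1 / 100)
  -- the block-volume weight `v⁻¹` moves at the rate `δ₀/50` with the constant `Λ_v²` (square of [4] Lemma 2.1 for `v^{−1/2}`)
  -- «of course with different constants» (p. 403): the `α₁`-dependent constant `Θ(α₁)` of §3 is continuous in `α₁`, hence `≦ K` below a threshold `ε`
  obtain ⟨K, ε, hK, hε, hKb⟩ := exists_bound_of_continuousAt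
    (f := fun α₁ : ℝ => (Fintype.card ι * M₂ * ∑ i, ‖b i‖) * Real.exp ((39 / 50 * δ₀ + 1 / 50 * δ₀) * d₀) * α₁ *
      (4 * Fintype.card κ + ((1 + 2 * Fintype.card κ) * ((2 + 8 * (1 : ℝ) ^ 2 * α₁) * Fintype.card κ) + a₀ * Cq * (2 + Cq * α₁)
        + 4 * Fintype.card κ * (1 : ℝ) ^ 2)))
    (by fun_prop)
  -- the constant of the kernel of `W = G′(U′U)V′(A)` and the final constant
  set AW : ℝ := (Λvf (1 / 100)) ^ 2 * (Λf (1 / 100)) * B6.c1 d δ₀ (1 / 100) * B' * K with hAW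
  have hAW0 : 0 ≤ AW := by rw [hAW]; positivity
  refine ⟨min a₁ (min (ε / 2) (1 / 4)), lt_min ha₁ (lt_min (half_pos hε) (by norm_num)),
    B46 * (1 + cv * (Λvf (1 / 100)) * AW * B6.c1 d δ₀ (1 / 100)), by positivity, ?_⟩
  -- NOW the lattice, the background, the data, the Theorems-for-`U` inputs (block and kernel members); then `α₁`, `A` and the `A`-letters
  intro S _ _ T U g _ _ _ Rr H blk kQ sQ cfun w hdnn htri hrefl hsym hlen hlenη hη h261 hST hU1 hd₀B hd₀F hd₀0 hw hcard hkQ hsQ hcfun Δp Gp hΔpGp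
    hGpΔp h342_1 h342_2 h342_3 v hv cK hcK hGpk hDGpk hGpDk hDGpDk hvol hSTv h346 α₁ hα₁0 hα₁1 A kF sF hkF hsF h337B h337F h337Bτ hA hAτB
  replace H16 := H16 T U blk kQ sQ cfun w hdnn htri hrefl hsym hlen hlenη hη h261 hST hU1 hd₀B hd₀F hd₀0 hw hcard hkQ hsQ hcfun hΔpGp hGpΔp h342_1
    h342_2 h342_3 hv hcK hGpk hDGpk hGpDk hDGpDk
  -- the p. 398 scale transfers at exponent `1/100`: the weights `(Lʲη)⁻¹`, `(Lʲη)⁻²` and the block-volume weight `v^{−1/2}`; [4] Lemma 2.1 at `β = 1/100`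
  obtain ⟨-, -, hT1i, hT2i, -, -⟩ := hST (1 / 100) (by norm_num)
  have hTv := hSTv (1 / 100) (by norm_num)
  have h261β : Ineq261 d (toB6 g Rr H) δ₀ (1 / 100) := h261 _ (by norm_num) (by norm_num)
  have hTv2 : ∀ a a' : g.Site, Real.exp (-(1 / 50 * δ₀ * g.dist a a')) * (v a)⁻¹ ≤ (Λvf (1 / 100)) ^ 2 * (v a')⁻¹ := by
    intro a a'
    have h1 := hTv a' a
    rw [hsym a' a] at h1
    have hs : 0 ≤ Real.exp (-(1 / 100 * δ₀ * g.dist a a')) * (Real.sqrt (v a))⁻¹ :=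
      mul_nonneg (Real.exp_nonneg _) (inv_nonneg.mpr (Real.sqrt_nonneg _))
    have h2 := mul_le_mul h1 h1 hs ((hs.trans h1))
    have e1 : Real.exp (-(1 / 100 * δ₀ * g.dist a a')) * (Real.sqrt (v a))⁻¹ * (Real.exp (-(1 / 100 * δ₀ * g.dist a a')) * (Real.sqrt (v a))⁻¹)
        = Real.exp (-(1 / 50 * δ₀ * g.dist a a')) * (v a)⁻¹ := by
      have hsq : (Real.sqrt (v a))⁻¹ * (Real.sqrt (v a))⁻¹ = (v a)⁻¹ := by
        rw [← mul_inv, Real.mul_self_sqrt (hv a).le]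
      calc Real.exp (-(1 / 100 * δ₀ * g.dist a a')) * (Real.sqrt (v a))⁻¹ * (Real.exp (-(1 / 100 * δ₀ * g.dist a a')) * (Real.sqrt (v a))⁻¹)
          = (Real.exp (-(1 / 100 * δ₀ * g.dist a a')) * Real.exp (-(1 / 100 * δ₀ * g.dist a a'))) * ((Real.sqrt (v a))⁻¹ * (Real.sqrt (v a))⁻¹) := by ring
        _ = Real.exp (-(1 / 50 * δ₀ * g.dist a a')) * (v a)⁻¹ := by
            rw [hsq, ← Real.exp_add]; congr 2; ring
    have e2 : (Λvf (1 / 100)) * (Real.sqrt (v a'))⁻¹ * ((Λvf (1 / 100)) * (Real.sqrt (v a'))⁻¹) = (Λvf (1 / 100)) ^ 2 * (v a')⁻¹ := by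
      have hsq : (Real.sqrt (v a'))⁻¹ * (Real.sqrt (v a'))⁻¹ = (v a')⁻¹ := by
        rw [← mul_inv, Real.mul_self_sqrt (hv a').le]
      calc (Λvf (1 / 100)) * (Real.sqrt (v a'))⁻¹ * ((Λvf (1 / 100)) * (Real.sqrt (v a'))⁻¹) = (Λvf (1 / 100)) ^ 2 * ((Real.sqrt (v a'))⁻¹ * (Real.sqrt (v a'))⁻¹) := by ring
        _ = (Λvf (1 / 100)) ^ 2 * (v a')⁻¹ := by rw [hsq]
    rw [e1, e2] at h2
    exact h2
  have hα₁a : α₁ ≤ a₁ := hα₁1.trans (min_le_left _ _)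
  have hα₁ε : α₁ ≤ ε / 2 := hα₁1.trans ((min_le_right _ _).trans (min_le_left _ _))
  have hα₁q : α₁ ≤ 1 / 4 := hα₁1.trans ((min_le_right _ _).trans (min_le_right _ _))
  obtain ⟨i1, i2, k1, -, k3, -⟩ := H16 α₁ hα₁0 hα₁a A kF sF hkF hsF h337B h337F h337Bτ hA hAτB
  have hθK : (Fintype.card ι * M₂ * ∑ i, ‖b i‖) * Real.exp ((39 / 50 * δ₀ + 1 / 50 * δ₀) * d₀) * α₁ *
      (4 * Fintype.card κ + ((1 + 2 * Fintype.card κ) * ((2 + 8 * (1 : ℝ) ^ 2 * α₁) * Fintype.card κ) + a₀ * Cq * (2 + Cq * α₁)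
        + 4 * Fintype.card κ * (1 : ℝ) ^ 2)) ≤ K :=
    hKb α₁ (by rw [abs_of_nonneg hα₁0]; linarith)
  -- the shapes in which §3 reads (3.37), the transports and the stencil geometry
  have hsmall : ∀ y : g.Site, g.eta * (α₁ * (g.len y)⁻¹) ≤ 1 / 4 := fun y => by
    have hq : g.eta * (g.len y)⁻¹ ≤ 1 := by
      rw [← div_eq_mul_inv]; exact (div_le_one (hlen y)).mpr (hlenη y)
    calc g.eta * (α₁ * (g.len y)⁻¹) = α₁ * (g.eta * (g.len y)⁻¹) := by ring
      _ ≤ α₁ * 1 := mul_le_mul_of_nonneg_left hq hα₁0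
      _ ≤ 1 / 4 := by linarith
  have hA' : ∀ μ x, ‖A μ x‖ ≤ α₁ * (g.len (blk x))⁻¹ ∧ ‖tauB T U μ (A μ) x‖ ≤ α₁ * (g.len (blk x))⁻¹ :=
    fun μ x => ⟨hA μ x, hAτB μ μ x⟩
  have h337s' : ∀ μ x, ‖((g.eta : ℂ)⁻¹) • covDstar T U μ (A μ) x‖ ≤ α₁ * (g.len (blk x) ^ 2)⁻¹ := fun μ x => h337B μ μ x
  have h337F' : ∀ μ x, ‖((g.eta : ℂ)⁻¹) • covD T U μ (A μ) x‖ ≤ α₁ * (g.len (blk x) ^ 2)⁻¹ := fun μ x => h337F μ μ x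
  have hd₀' : ∀ μ x, g.dist (blk x) (blk (T μ x)) ≤ d₀ ∧ g.dist (blk x) (blk ((T μ).symm x)) ≤ d₀ :=
    fun μ x => ⟨hd₀F μ x, hd₀B μ x⟩
  -- abbreviations
  set V' : Module.End ℝ (S × ι → ℝ) := conj b (vPrimeConc T U g.eta A blk kQ kF sQ sF cfun) with hV'
  set GE : Module.End ℝ (S × ι → ℝ) := gPrimeExtEnd Gp (V' * Gp) with hGE
  -- FILE 16's kernel entries (3.42)₁,₃ of `G′(U′U)` in the weight shapes §3 reads (`w_T = (Lʲη)²`, `w_T·(Lʲη)⁻¹ = Lʲη`)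
  have hl21 : ∀ a : g.Site, g.len a ^ 2 * (g.len a)⁻¹ = g.len a := fun a => by
    rw [pow_two, mul_assoc, mul_inv_cancel₀ (hlen a).ne', mul_one]
  have hl22 : ∀ a : g.Site, g.len a ^ 2 * (g.len a ^ 2)⁻¹ = 1 := fun a => mul_inv_cancel₀ (pow_ne_zero 2 (hlen a).ne')
  have k3' : ∀ l : κ ⊕ κ, HasKernelBound (g := toB6 g Rr H) (fun p : S × ι => blk p.1) v cK (GE * conj b (diffLetter T U ((g.eta : ℂ)⁻¹) l))
      (fun a a' => B' * (g.len a ^ 2 * (g.len a)⁻¹) * Real.exp (-(4 / 5 * δ₀ * g.dist a a'))) := fun l =>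
    hasKernelBound_mono (g := toB6 g Rr H) _ hv (k3 l) fun a a' => le_of_eq (by rw [hl21])
  -- §3: the kernel of `W = G′(U′U)·V′(A)` (V′ on the RIGHT) at the rate `39δ₀/50` (`ρ + (1/100 + 1/100)δ₀ ≦ 4δ₀/5`), weight `(Lʲη)²·(Lʲη)⁻² = 1`
  have hr : 39 / 50 * δ₀ + (1 / 100 + 1 / 100) * δ₀ ≤ 4 / 5 * δ₀ := by linarith
  have hW0 := hasKernelBound_mul_vPrime_right (Rr := Rr) (H := H) b T U blk d hη A kQ kF sQ sF cfun w 1 d₀ M₂ Cq a₀ δ₀ (4 / 5 * δ₀) (1 / 100) (1 / 100)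
    (1 / 50 * δ₀) (39 / 50 * δ₀) (Λf (1 / 100)) ((Λvf (1 / 100)) ^ 2) B' α₁ (fun a => g.len a ^ 2) hv hcK hB' hα₁0 hΛ0 (by positivity) (by linarith) (by linarith) hr hdnn htri
    hlen h261β (fun a => sq_nonneg _) hT1i hT2i hTv2 hM₂ hrepr hsmall hA' h337s' h337F' h337Bτ hU1 hd₀' hd₀0 hw hcard hCq ha₀ hkQ hkF hsQ hsF hcfun
    (Tr := GE) k1 k3'
  have hW : HasKernelBound (g := toB6 g Rr H) (fun p : S × ι => blk p.1) v cK (GE * V') (fun a a' => AW * Real.exp (-(39 / 50 * δ₀ * g.dist a a'))) := by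
    refine hasKernelBound_mono (g := toB6 g Rr H) _ hv hW0 fun a a' => ?_
    rw [hl22, mul_one]
    refine mul_le_mul_of_nonneg_right ?_ (Real.exp_nonneg _)
    have e39 : (39 / 50 * δ₀ + 1 / 50 * δ₀) = (39 / 50 * δ₀ + 1 / 50 * δ₀) := rfl
    have hpre : 0 ≤ (Λvf (1 / 100)) ^ 2 * (Λf (1 / 100)) * B6.c1 d δ₀ (1 / 100) * B' := by positivity
    calc (Λvf (1 / 100)) ^ 2 * (Λf (1 / 100)) * B6.c1 d δ₀ (1 / 100) * B' * ((Fintype.card ι * M₂ * ∑ i, ‖b i‖) * Real.exp ((39 / 50 * δ₀ + 1 / 50 * δ₀) * d₀) * α₁ *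
          (4 * Fintype.card κ + ((1 + 2 * Fintype.card κ) * ((2 + 8 * (1 : ℝ) ^ 2 * α₁) * Fintype.card κ) + a₀ * Cq * (2 + Cq * α₁)
            + 4 * Fintype.card κ * (1 : ℝ) ^ 2)))
        ≤ (Λvf (1 / 100)) ^ 2 * (Λf (1 / 100)) * B6.c1 d δ₀ (1 / 100) * B' * K := mul_le_mul_of_nonneg_left hθK hpre
      _ = AW := by rw [hAW]
  -- (3.65)₂ in resolvent form, from the two inverse identities: `G′(U′U) = G′(U) + G′(U′U)·V′(A)·G′(U)`
  have hres : GE = Gp + GE * V' * Gp := resolvent_right (Δa := Δp) (V := V') (G := Gp) (GExt := GE) hΔpGp i2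
  refine ⟨i1, i2, fun k m y y' hf μ Hh hHh hh hh0 hμ0 => ?_⟩
  -- `E = G′(U′U)∇_k∇_m = T₀ + W·T₀` with `T₀ = G′(U)∇_k∇_m`
  have hE : GE * conj b (diffLetter T U ((g.eta : ℂ)⁻¹) k) * conj b (diffLetter T U ((g.eta : ℂ)⁻¹) m) =
      Gp * conj b (diffLetter T U ((g.eta : ℂ)⁻¹) k) * conj b (diffLetter T U ((g.eta : ℂ)⁻¹) m) +
        (GE * V') * (Gp * conj b (diffLetter T U ((g.eta : ℂ)⁻¹) k) * conj b (diffLetter T U ((g.eta : ℂ)⁻¹) m)) := by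
    conv_lhs => rw [hres]
    simp only [add_mul, mul_assoc]
  -- rates of §4: `ρ = 39δ₀/50` (kernel of W), `ρ′ = 77δ₀/100` (Schur transfer of `v^{−1/2}` at `1/100`), `ρ″ = 19δ₀/25` ([4] (2.61) at `1/100`), `r = δ₀`
  have hρ'ρ : 77 / 100 * δ₀ + 1 / 100 * δ₀ ≤ 39 / 50 * δ₀ := by linarith
  have hρ''ρ' : 19 / 25 * δ₀ + 1 / 100 * δ₀ ≤ 77 / 100 * δ₀ := by linarith
  have hρ''r : 19 / 25 * δ₀ ≤ δ₀ := by linarith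
  exact l2_right_transfer (R := Rr) (H := H) (fun p : S × ι => blk p.1) hv hcK hvol d hB46 hAW0 (by linarith) hρ'ρ hρ''ρ' hρ''r hdnn htri
    h261β hTv hE (h346 k m) hW y y' hf μ Hh hHh hh hh0 hμ0

end L2RU1

end Literature.MathematicalPhysics.QuantumFieldTheory.Balaban1983to89.B9Ineq346L2RightDiffUniform

end
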